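import Summits.HodgeConjecture.HodgeConjecture.Theorems.AnchorTransportVariationalHodgeAnalyticInterior
import Summits.HodgeConjecture.HodgeConjecture.Theorems.WeilTypeLadderVariational
import Literature.AlgebraicGeometry.HodgeTheory.AlgebraicityLocusIUnionClosedProofs
import Literature.AlgebraicGeometry.Motives.CurveThroughTwoPointsProofs
import HarnessLib

/-!
# WeilTypeLadder · R3var — LOCAL ⟹ GLOBAL for the algebraicity locus over any smooth irreducible quasi-projective base

b2b cell `hweil`, prover 2 (variational). The one density statement every deformation-theoretic engine
(Bloch 1972 / Buchweitz–Flenner 2003 Thm. 5.1 / Pridham / Perry 2026; Markman's secant sheaves) outputs is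
LOCAL: an algebraic anchor propagates to a non-empty Euclidean-OPEN set of fibres. The lead c3 of crux
stmt-HodgeConjecture-14497 certified LOCAL ⟹ CORE over sectioned affine CURVES
(`Theorems/HeckePrymWeilWeilVariationalHodgeCoreForms.lean`, p144787) after reducing the crux — which has no
quasi-projectivity hypotheses — to curves. The variational rung R3var
(`WeilTypeLadder.WeilVariationalHodgeCMField`, `Theorems/WeilTypeLadderVariational.lean`, p175609) carries
the engine-ready hypotheses (`IsQuasiProjectiveOver 𝒳`, `IsQuasiProjectiveOver S`, `S` smooth irreducible)
by design, so for it LOCAL ⟹ GLOBAL holds over the GIVEN base, with no curve reduction, by three theorems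
of the tree:

* `charlesSchnell_algebraicityLocus_iUnion_closed_holds` (Charles–Schnell 2014, proof of Prop. 11.3.11;
  `AlgebraicityLocusIUnionClosedProofs`): the algebraicity locus of a global class is `⋃ⱼ Wⱼ(ℂ)` for
  countably many Zariski-closed `Wⱼ ⊆ S`;
* `not_subset_iUnion_of_interior_nonempty` (`AnchorTransportVariationalHodgeAnalyticInterior`): over a smooth
  irreducible AFFINE base, no set of complex points with non-empty analytic interior is covered by countably
  many proper Zariski-closed sets of complex points (Baire + Mumford's curve lemma);
* `mumford_smoothCurve_through_two_points_holds` (`Motives/CurveThroughTwoPointsProofs`): Mumford's lemma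
  is a theorem of the tree, so the previous item is unconditional.

Proved here (sorry-free, no named-fact hypothesis, no definition):

* `mem_algebraicClasses_of_interior_algebraicityLocus_nonempty` — for `f : 𝒳 ⟶ S` a smooth projective
  family with quasi-projective `𝒳`, `S` and `S` smooth irreducible, and a global class
  `A ∈ H²ᵖ(𝒳(ℂ); ℂ)`: if the algebraicity locus `{t ∈ S(ℂ) | A|_{𝒳_t} ∈ algebraicClasses (𝒳_t) p}` has
  NON-EMPTY INTERIOR in `S(ℂ)`, it is ALL of `S(ℂ)`. (Affine open `W` through an interior point; the
  traces `Wⱼ ∩ W` cannot all be proper by the Baire lemma on `W(ℂ)`; a closed `Wⱼ ⊇ W` of the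
  irreducible `S` is `S`.)
* `mem_algebraicClasses_of_isOpen_subset_algebraicityLocus` — the same with an explicit non-empty open
  `U ⊆` locus.
* `weilVariationalHodgeCMField_of_local` — hence R3var follows from its LOCAL form: in the binders of
  `WeilVariationalHodgeCMField`, it suffices that ONE algebraic fibre force a non-empty open set of
  algebraic fibres. This is the exact interface an engine must hit for Markman's CM-field reduction
  (arXiv:2509.23079 Cor. 11.2.4) to bite, uniformly in the CM field and the dimension
  (cell analysis `run/shared/lean/b2b/hodge-weil/b2b-hweil-pv2/COR-11-2-4.md` §4, §6).

Serves stmt-HodgeConjecture-14497 without closing it.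
-/

-- every declaration of this problem lives in `Summit.HodgeConjecture.HodgeConjecture.…` (summit = sub-problem)
set_option linter.dupNamespace false

noncomputable section

open CategoryTheory AlgebraicGeometry TopologicalSpace

namespace Summit.HodgeConjecture.HodgeConjecture.WeilTypeLadder

open Literature.AlgebraicGeometry Literature.AlgebraicGeometry.Motives
open Literature.AlgebraicGeometry.HodgeTheory
open Literature.AlgebraicTopology.SingularHomology
open Summit.HodgeConjecture.HodgeConjecture.Theorems

/-! ### LOCAL ⟹ GLOBAL for the algebraicity locus -/

/-- **An algebraicity locus with non-empty analytic interior is everything.** For a smooth projective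
family `f : 𝒳 ⟶ S` of relative dimension `n` with `𝒳`, `S` quasi-projective over `ℂ` and `S` smooth and
irreducible, and a global class `A ∈ H²ᵖ(𝒳(ℂ); ℂ)`: if `{t ∈ S(ℂ) | A|_{𝒳_t} ∈ algebraicClasses (𝒳_t) p}`
has non-empty interior in `S(ℂ)`, then `A|_{𝒳_t}` is algebraic for EVERY complex point `t`.
Proof: the locus is `⋃ⱼ Wⱼ(ℂ)` with `Wⱼ ⊆ S` Zariski-closed (Charles–Schnell); through an interior point
`u` choose an affine open `W ∋ pt u`, a smooth irreducible affine `ℂ`-scheme whose complex points map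
continuously into `S(ℂ)`; the preimage of the locus has non-empty interior in `W(ℂ)` and is covered by the
complex points of the closed traces `Wⱼ ∩ W`, so one trace is all of `W` (Baire lemma
`not_subset_iUnion_of_interior_nonempty`, Mumford's lemma discharged); then the closed `Wⱼ` contains the
dense open `W` of the irreducible `S`, i.e. `Wⱼ = S`. [cite: CharlesSchnell2014Notes, Prop. 11.3.11 (proof)]
[cite: MumfordAV1970, §6, Lemma] -/
theorem mem_algebraicClasses_of_interior_algebraicityLocus_nonempty {𝒳 S : SchemeOver ℂ} (f : 𝒳 ⟶ S)
    {n p : ℕ} (h𝒳 : IsQuasiProjectiveOver 𝒳) (hS : IsQuasiProjectiveOver S) [IrreducibleSpace S.left]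
    (hsm : AlgebraicGeometry.Smooth S.hom) (hf : IsSmoothProjectiveFamily f n)
    (A : complexBetti 𝒳 (2 * p))
    (hint : (interior {t : ComplexPoints S |
      complexBetti.map (fiberι f t) (2 * p) A ∈ algebraicClasses (fiberOver f t) p}).Nonempty) :
    ∀ t : ComplexPoints S,
      complexBetti.map (fiberι f t) (2 * p) A ∈ algebraicClasses (fiberOver f t) p := by
  haveI := hsm
  -- the locus is a countable union of complex points of Zariski-closed subsets
  obtain ⟨Z, hZc, hΛ⟩ := charlesSchnell_algebraicityLocus_iUnion_closed_holds f n p h𝒳 hS hsm hf A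
  set Λ := {t : ComplexPoints S |
    complexBetti.map (fiberι f t) (2 * p) A ∈ algebraicClasses (fiberOver f t) p} with hΛdef
  obtain ⟨u, hu⟩ := hint
  -- an affine open `W ∋ pt u`, as a smooth irreducible affine `ℂ`-scheme
  obtain ⟨W, hW, huW, -⟩ := exists_isAffineOpen_mem_and_subset (U := ⊤) (x := u.pt) trivial
  set g := openSubschemeOverι S W with hg
  haveI : IsOpenImmersion g.left := inferInstanceAs (IsOpenImmersion W.ι)
  haveI hWaff : IsAffine (openSubschemeOver S W).left := hW
  haveI hWirr : IrreducibleSpace (openSubschemeOver S W).left := by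
    change IrreducibleSpace W
    exact isIrreducible_iff_irreducibleSpace.mp ⟨⟨u.pt, huW⟩,
      (PreirreducibleSpace.isPreirreducible_univ (X := S.left)).open_subset W.isOpen
        (Set.subset_univ _)⟩
  haveI hWsm : AlgebraicGeometry.Smooth (openSubschemeOver S W).hom := by
    change AlgebraicGeometry.Smooth (W.ι ≫ S.hom)
    infer_instance
  -- the traces `Zⱼ ∩ W` and the pulled-back locus
  set Z' : ℕ → Set (openSubschemeOver S W).left := fun k => g.left.base ⁻¹' Z k with hZ'
  have hZ'c : ∀ k, IsClosed (Z' k) := fun k => (hZc k).preimage g.left.base.hom.continuous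
  set Λ' : Set (ComplexPoints (openSubschemeOver S W)) := AlgPoints.map g ⁻¹' Λ with hΛ'
  have hΛ'int : (interior Λ').Nonempty := by
    obtain ⟨u', rfl⟩ : ∃ u' : ComplexPoints (openSubschemeOver S W), AlgPoints.map g u' = u :=
      ⟨AlgPoints.liftOfMemOpensRange g u ⟨⟨u.pt, huW⟩, rfl⟩, AlgPoints.map_liftOfMemOpensRange g u _⟩
    have hO : IsOpen (AlgPoints.map g ⁻¹' interior Λ) :=
      isOpen_interior.preimage (AlgPoints.continuous_map g)
    have hOsub : AlgPoints.map g ⁻¹' interior Λ ⊆ Λ' := fun c hc =>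
      (interior_subset (s := Λ) hc : AlgPoints.map g c ∈ Λ)
    exact ⟨u', (hO.subset_interior_iff.2 hOsub) hu⟩
  have hΛ'sub : Λ' ⊆ ⋃ k, {t' : ComplexPoints (openSubschemeOver S W) | t'.pt ∈ Z' k} := by
    intro t' ht'
    have h1 : AlgPoints.map g t' ∈ ⋃ j, {t : ComplexPoints S | t.pt ∈ Z j} := by
      rw [← hΛ]; exact ht'
    obtain ⟨k, hk⟩ := Set.mem_iUnion.1 h1
    exact Set.mem_iUnion.2 ⟨k, (hk : (AlgPoints.map g t').pt ∈ Z k)⟩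
  -- Baire on the affine `W(ℂ)`: some trace is all of `W`
  have hex : ∃ k, Z' k = Set.univ := by
    by_contra hne
    exact not_subset_iUnion_of_interior_nonempty mumford_smoothCurve_through_two_points_holds
      Λ' hΛ'int Z' hZ'c (fun k hk => hne ⟨k, hk⟩) hΛ'sub
  obtain ⟨k, hk⟩ := hex
  -- `W ⊆ Z k`, so `Z k = S` by irreducibility
  have hWZ : (W : Set S.left) ⊆ Z k := fun x hx => by
    have : (⟨x, hx⟩ : W) ∈ Z' k := hk ▸ Set.mem_univ _
    exact this
  have hdense : Dense (W : Set S.left) := W.isOpen.dense ⟨u.pt, huW⟩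
  have hZk : Z k = Set.univ := by
    rw [← Set.univ_subset_iff, ← hdense.closure_eq]
    exact closure_minimal hWZ (hZc k)
  -- every complex point lies over `Z k = S`, hence in the locus
  intro t
  have ht : t ∈ ⋃ j, {t : ComplexPoints S | t.pt ∈ Z j} :=
    Set.mem_iUnion.2 ⟨k, by simp [hZk]⟩
  rw [← hΛ] at ht
  exact ht

/-- **A non-empty analytic-open set of algebraic fibres forces all fibres to be algebraic** (the same,
with an explicit open `U`). [cite: CharlesSchnell2014Notes, Prop. 11.3.11 (proof)] [cite: MumfordAV1970, §6, Lemma] -/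
theorem mem_algebraicClasses_of_isOpen_subset_algebraicityLocus {𝒳 S : SchemeOver ℂ} (f : 𝒳 ⟶ S)
    {n p : ℕ} (h𝒳 : IsQuasiProjectiveOver 𝒳) (hS : IsQuasiProjectiveOver S) [IrreducibleSpace S.left]
    (hsm : AlgebraicGeometry.Smooth S.hom) (hf : IsSmoothProjectiveFamily f n)
    (A : complexBetti 𝒳 (2 * p)) {U : Set (ComplexPoints S)} (hU : IsOpen U) (hUne : U.Nonempty)
    (hUalg : ∀ t ∈ U, complexBetti.map (fiberι f t) (2 * p) A ∈ algebraicClasses (fiberOver f t) p) :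
    ∀ t : ComplexPoints S,
      complexBetti.map (fiberι f t) (2 * p) A ∈ algebraicClasses (fiberOver f t) p :=
  mem_algebraicClasses_of_interior_algebraicityLocus_nonempty f h𝒳 hS hsm hf A
    (hUne.mono (interior_maximal (fun t ht => hUalg t ht) hU))

/-! ### R3var from its LOCAL form -/

/-- **R3var ⟸ LOCAL-R3var.** In the binders of `WeilVariationalHodgeCMField` (CM field `ℚ[T]/(P)`, smooth
projective `K`-Weil family with quasi-projective total space over a smooth irreducible quasi-projective
base, global class `W` fibrewise rational of type `(m,m)` in the Weil space through charts), suppose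
that ONE algebraic fibre always forces a NON-EMPTY EUCLIDEAN-OPEN set of algebraic fibres (the output of
any semiregularity / secant-sheaf engine at the anchor). Then R3var holds: every fibre is algebraic
(`mem_algebraicClasses_of_isOpen_subset_algebraicityLocus`). The CM and Weil hypotheses are passed
through untouched — the density step is blind to them. [cite: CharlesSchnell2014Notes, Prop. 11.3.11 (proof)]
[cite: Markman2025SecantRealMultiplication, Cor. 11.2.4 and Thm. 1.1.2] -/
theorem weilVariationalHodgeCMField_of_local
    (hloc : ∀ (P : Polynomial ℤ) (e m : ℕ), P.Monic → P.natDegree = e →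
      Irreducible (P.map (Int.castRingHom ℚ)) →
      (∀ ρ : ℂ, Polynomial.eval₂ (Int.castRingHom ℂ) ρ P = 0 → starRingEnd ℂ ρ ≠ ρ) →
      (∃ Q : Polynomial ℚ, ∀ ρ : ℂ, Polynomial.eval₂ (Int.castRingHom ℂ) ρ P = 0 →
          Polynomial.eval₂ (algebraMap ℚ ℂ) ρ Q = starRingEnd ℂ ρ) →
      1 ≤ m →
      ∀ ⦃𝒳 S : Motives.SchemeOver ℂ⦄ (f : 𝒳 ⟶ S), Motives.IsSmoothProjectiveFamily f (e * m) →
        IsQuasiProjectiveOver 𝒳 → IsQuasiProjectiveOver S → IrreducibleSpace S.left →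
        AlgebraicGeometry.Smooth S.hom →
        ∀ (W : complexBetti 𝒳 (2 * m)),
          (∀ s : Motives.ComplexPoints S,
            IsRationalClass (complexBetti.map (Motives.fiberι f s) (2 * m) W) ∧
              IsOfHodgeType (e * m) (Motives.fiberOver f s) (2 * m) m m
                (complexBetti.map (Motives.fiberι f s) (2 * m) W)) →
          (∀ s : Motives.ComplexPoints S, ∃ (A' : Motives.AbelianVariety ℂ) (φ' : A' ⟶ A')
              (e' : A'.X ≅ Motives.fiberOver f s),
            Polynomial.eval₂ (Int.castRingHom (CategoryTheory.End A')) (φ' : CategoryTheory.End A') P = 0 ∧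
              e * (2 * m) = 2 * A'.dim ∧
              complexBetti.map e'.hom (2 * m) (complexBetti.map (Motives.fiberι f s) (2 * m) W) ∈
                weilClassesField A' φ' P (2 * m)) →
          (∃ s₀ : Motives.ComplexPoints S,
            complexBetti.map (Motives.fiberι f s₀) (2 * m) W ∈
              algebraicClasses (Motives.fiberOver f s₀) m) →
          ∃ U : Set (Motives.ComplexPoints S), IsOpen U ∧ U.Nonempty ∧
            ∀ t ∈ U, complexBetti.map (Motives.fiberι f t) (2 * m) W ∈
              algebraicClasses (Motives.fiberOver f t) m) :
    WeilVariationalHodgeCMField := by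
  intro P e m hP hPe hirr hnr hQ hm 𝒳 S f hf h𝒳 hS hirrS hsm W hW hWeil hs₀ s
  obtain ⟨U, hU, hUne, hUalg⟩ := hloc P e m hP hPe hirr hnr hQ hm f hf h𝒳 hS hirrS hsm W hW hWeil hs₀
  exact mem_algebraicClasses_of_isOpen_subset_algebraicityLocus f h𝒳 hS hsm hf W hU hUne hUalg s

end Summit.HodgeConjecture.HodgeConjecture.WeilTypeLadder

end
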